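import Mathlib
import HarnessLib
import Summits.NavierStokesRegularity.NavierStokesRegularity.Theses.SymmetryModuliCount
import Literature.Analysis.FluidPDE.TypeIAncientMild
import Literature.Analysis.FluidPDE.KNSSTypeIRateMildProofs

/-!
# Crux `FarPastLedger` (stmt-NavierStokesRegularity-14060), line `uloc-gronwall-transplant`: the reduction to the unit window

Composition file of the lead's skeleton (`Cruxes/FarPastLedger/Lines/uloc_gronwall_transplant.lean`):
the class `A_C = IsTypeIAncientMild C` is invariant under the parabolic scaling `u ↦ c u(c²t, cx)`
and under spatial translations, and the ledger `∫_{B_R(x₀)}|u(t)|²` scales exactly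
(adapted from the standing disprover's `Cruxes/FarPastLedger/Disproof.lean` §6), so the crux
`SymmetryModuliCount.FarPastLedger` follows from its unit-window form
`∀ C ∃ K ∀ u ∈ A_C ∀ t ∈ (−1,0), ∫_{B₁(0)}|u(t)|² ≤ K` (`crux_of_unitWindow`, registered sub-goal
`fpl_reduction_main`).
-/

noncomputable section

open MeasureTheory Set Filter Metric Topology
open Literature.Analysis.FluidPDE Literature.Analysis.UnboundedOperators

set_option linter.dupNamespace false -- nested layout Summit.<S>.<Sub>, Sub = S (D-0017)

namespace Summit.NavierStokesRegularity.NavierStokesRegularity.Theorems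

/-- **`A_C` is invariant under the parabolic scaling** `u ↦ c u(c²t, cx)`, `c > 0`
(adapted from `Cruxes/FarPastLedger/Disproof.lean` §6, `isTypeIAncientMild_nsRescale`). -/
theorem isTypeIAncientMild_nsRescale {C : ℝ} {u : ℝ → EuclideanSpace ℝ (Fin 3) → EuclideanSpace ℝ (Fin 3)} (h : IsTypeIAncientMild C u) {c : ℝ}
    (hc : 0 < c) : IsTypeIAncientMild C (nsRescale c u) := by
  have hc2 : 0 < c ^ 2 := pow_pos hc 2
  refine ⟨?_, fun t ht => ?_, fun s t hst ht x => ?_, h.hasTypeITimeDecay.nsRescale hc⟩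
  · have e : Function.uncurry (nsRescale c u) =
        fun p : ℝ × EuclideanSpace ℝ (Fin 3) => c • Function.uncurry u (c ^ 2 * p.1, c • p.2) := by
      funext p; rfl
    rw [e]
    refine (h.contDiffOn.comp
      ((contDiff_const.mul contDiff_fst).prodMk (contDiff_snd.const_smul c)).contDiffOn
      fun p hp => ?_).const_smul c
    have hp1 : p.1 < 0 := hp.1
    exact mk_mem_prod (mul_neg_of_pos_of_neg hc2 hp1) (mem_univ _)
  · have hct : c ^ 2 * t < 0 := mul_neg_of_pos_of_neg hc2 ht
    have hd : VectorCalculus.IsDivFree (fun x : EuclideanSpace ℝ (Fin 3) => u (c ^ 2 * t) (c • x)) :=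
      (h.isDivFree hct).comp_smul c
    have hdiff : Differentiable ℝ (fun x : EuclideanSpace ℝ (Fin 3) => u (c ^ 2 * t) (c • x)) :=
      ((h.contDiff_slice hct).differentiable (by simp)).comp (differentiable_id.const_smul c)
    intro x
    have e : nsRescale c u t = fun y => c • (fun z : EuclideanSpace ℝ (Fin 3) => u (c ^ 2 * t) (c • z)) y := rfl
    rw [e]
    simp only [VectorCalculus.divergence, fderiv_fun_const_smul (hdiff x) c,
      ContinuousLinearMap.toLinearMap_smul, map_smul, smul_eq_mul]
    have key := hd x
    simp only [VectorCalculus.divergence] at key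
    rw [key, mul_zero]
  · have hst' : (0 : ℝ) + c ^ 2 * s < 0 + c ^ 2 * t := by nlinarith
    have ht' : (0 : ℝ) + c ^ 2 * t < 0 := by nlinarith
    have hu : ∀ X, u (0 + c ^ 2 * t) X = heatExtension (u (0 + c ^ 2 * s)) (0 + c ^ 2 * t - (0 + c ^ 2 * s)) X -
        oseenDuhamel 1 (0 + c ^ 2 * s) u u (0 + c ^ 2 * t) X :=
      fun X => h.mild_eq_heatExtension hst' ht' X
    have key := oseen_smul_stPull hc 0 (0 : EuclideanSpace ℝ (Fin 3)) hst hu x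
    have e2 : nsRescale c u = c • stPull (c ^ 2) c 0 0 u := by
      funext s' y
      simp only [nsRescale_apply, Pi.smul_apply, stPull_apply, zero_add]
    rw [e2, heatFlow_of_pos _ (sub_pos.2 hst)]
    exact key

/-- Scaling law of the local energy: `∫_{B_R(x₀)} |u_c(t)|² = c⁻¹ ∫_{B_{cR}(cx₀)} |u(c²t)|²`
(adapted from `Disproof.lean` §6). -/
theorem setIntegral_ball_nsRescale {c : ℝ} (hc : 0 < c) (u : ℝ → EuclideanSpace ℝ (Fin 3) → EuclideanSpace ℝ (Fin 3)) (t : ℝ) (x₀ : EuclideanSpace ℝ (Fin 3)) (R : ℝ) :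
    ∫ x in ball x₀ R, ‖nsRescale c u t x‖ ^ 2 =
      c⁻¹ * ∫ y in ball (c • x₀) (c * R), ‖u (c ^ 2 * t) y‖ ^ 2 := by
  have e : ∀ x, ‖nsRescale c u t x‖ ^ 2 = c ^ 2 * (fun y => ‖u (c ^ 2 * t) y‖ ^ 2) (c • x) := fun x => by
    simp only [nsRescale_apply, norm_smul, Real.norm_of_nonneg hc.le, mul_pow]
  simp_rw [e]
  rw [integral_const_mul, Measure.setIntegral_comp_smul_of_pos volume (fun y => ‖u (c ^ 2 * t) y‖ ^ 2)
    (ball x₀ R) hc, smul_ball hc.ne' x₀ R, Real.norm_of_nonneg hc.le, finrank_euclideanSpace_fin, smul_eq_mul]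
  field_simp

/-- **`A_C` is invariant under spatial translations** (adapted from `Disproof.lean` §6). -/
theorem isTypeIAncientMild_translate {C : ℝ} {u : ℝ → EuclideanSpace ℝ (Fin 3) → EuclideanSpace ℝ (Fin 3)} (h : IsTypeIAncientMild C u) (x₀ : EuclideanSpace ℝ (Fin 3)) :
    IsTypeIAncientMild C (fun t x => u t (x₀ + x)) := by
  refine ⟨?_, fun t ht => ?_, fun s t hst ht x => ?_, fun t ht x => h.norm_le ht _⟩
  · have e : Function.uncurry (fun t x => u t (x₀ + x)) =
        fun p : ℝ × EuclideanSpace ℝ (Fin 3) => Function.uncurry u (p.1, x₀ + p.2) := by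
      funext p; rfl
    rw [e]
    exact h.contDiffOn.comp (contDiff_fst.prodMk (contDiff_const.add contDiff_snd)).contDiffOn
      fun p hp => mk_mem_prod hp.1 (mem_univ _)
  · intro x
    have key := h.isDivFree ht (x₀ + x)
    simp only [VectorCalculus.divergence] at key ⊢
    rw [fderiv_comp_add_left]
    exact key
  · have hu : ∀ X, u (0 + (1 : ℝ) ^ 2 * t) X =
        heatExtension (u (0 + (1 : ℝ) ^ 2 * s)) (0 + (1 : ℝ) ^ 2 * t - (0 + (1 : ℝ) ^ 2 * s)) X -
          oseenDuhamel 1 (0 + (1 : ℝ) ^ 2 * s) u u (0 + (1 : ℝ) ^ 2 * t) X := by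
      intro X
      simpa using h.mild_eq_heatExtension hst ht X
    have key := oseen_smul_stPull one_pos 0 x₀ hst hu x
    have e2 : (fun t x => u t (x₀ + x)) = (1 : ℝ) • stPull ((1 : ℝ) ^ 2) 1 0 x₀ u := by
      funext s' y
      simp only [Pi.smul_apply, stPull_apply, one_pow, one_mul, zero_add, one_smul]
    rw [e2, heatFlow_of_pos _ (sub_pos.2 hst)]
    exact key

/-- Translation of the local energy: `∫_{B_R(0)} |u(t, x₀ + y)|² dy = ∫_{B_R(x₀)} |u(t)|²`. -/
theorem setIntegral_ball_translate (u : ℝ → EuclideanSpace ℝ (Fin 3) → EuclideanSpace ℝ (Fin 3)) (t : ℝ) (x₀ : EuclideanSpace ℝ (Fin 3)) (R : ℝ) :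
    ∫ y in ball (0 : EuclideanSpace ℝ (Fin 3)) R, ‖u t (x₀ + y)‖ ^ 2 = ∫ y in ball x₀ R, ‖u t y‖ ^ 2 := by
  rw [← integral_indicator measurableSet_ball, ← integral_indicator measurableSet_ball]
  have e : (ball (0 : EuclideanSpace ℝ (Fin 3)) R).indicator (fun y => ‖u t (x₀ + y)‖ ^ 2) =
      fun y => (ball x₀ R).indicator (fun y => ‖u t y‖ ^ 2) (x₀ + y) := by
    funext y
    by_cases hy : y ∈ ball (0 : EuclideanSpace ℝ (Fin 3)) R
    · have hy' : x₀ + y ∈ ball x₀ R := by simpa [mem_ball, dist_eq_norm] using hy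
      simp [Set.indicator, hy, hy']
    · have hy' : x₀ + y ∉ ball x₀ R := by simpa [mem_ball, dist_eq_norm] using hy
      simp [Set.indicator, hy, hy']
  rw [e, integral_add_left_eq_self]

/-- **Reduction**: the unit-window ledger implies the crux (scale by `R`, translate by `x₀`; for
`t/R² ≤ −1` the unit ball lies in the parabolic interior where Type I alone gives `C²|B₁|`). -/
theorem crux_of_unitWindow
    (h : ∀ C : ℝ, ∃ K : ℝ, ∀ (u : ℝ → EuclideanSpace ℝ (Fin 3) → EuclideanSpace ℝ (Fin 3)),
      IsTypeIAncientMild C u → ∀ t ∈ Ioo (-1 : ℝ) 0,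
      ∫ x in ball (0 : EuclideanSpace ℝ (Fin 3)) 1, ‖u t x‖ ^ 2 ≤ K) :
    Summit.NavierStokesRegularity.NavierStokesRegularity.Theses.SymmetryModuliCount.FarPastLedger := by
  intro C
  obtain ⟨K, hK⟩ := h C
  -- Step 1: unit ball at the origin, all `t < 0` (Type I for `t ≤ -1`).
  set V : ℝ := (volume (ball (0 : EuclideanSpace ℝ (Fin 3)) 1)).toReal with hV
  set K₁ : ℝ := max K (C ^ 2 * V) with hK₁
  have h1 : ∀ (u : ℝ → EuclideanSpace ℝ (Fin 3) → EuclideanSpace ℝ (Fin 3)), IsTypeIAncientMild C u → ∀ t < 0,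
      ∫ x in ball (0 : EuclideanSpace ℝ (Fin 3)) 1, ‖u t x‖ ^ 2 ≤ K₁ := by
    intro u hu t ht
    rcases lt_or_ge (-1 : ℝ) t with h1 | h1
    · exact (hK u hu t ⟨h1, ht⟩).trans (le_max_left _ _)
    · refine le_trans ?_ (le_max_right _ _)
      have hpt : ∀ x, ‖u t x‖ ^ 2 ≤ C ^ 2 := fun x => by
        have h1' := hu.norm_le ht x
        have hs1 : 1 ≤ Real.sqrt (-t) := by
          rw [← Real.sqrt_one]; exact Real.sqrt_le_sqrt (by linarith)
        have h2 : C / Real.sqrt (-t) ≤ C := div_le_self hu.nonneg hs1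
        exact pow_le_pow_left₀ (norm_nonneg _) (h1'.trans h2) 2
      calc ∫ x in ball (0 : EuclideanSpace ℝ (Fin 3)) 1, ‖u t x‖ ^ 2 ≤ ∫ _x in ball (0 : EuclideanSpace ℝ (Fin 3)) 1, C ^ 2 :=
            integral_mono_of_nonneg (Eventually.of_forall fun x => by positivity)
              (integrableOn_const measure_ball_lt_top.ne) (Eventually.of_forall hpt)
        _ = C ^ 2 * V := by
            rw [setIntegral_const, smul_eq_mul, measureReal_def, mul_comm]
  -- Step 2: all centres (translation invariance of the class).
  have h2 : ∀ (u : ℝ → EuclideanSpace ℝ (Fin 3) → EuclideanSpace ℝ (Fin 3)), IsTypeIAncientMild C u → ∀ t < 0, ∀ x₀ : EuclideanSpace ℝ (Fin 3),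
      ∫ x in ball x₀ 1, ‖u t x‖ ^ 2 ≤ K₁ := by
    intro u hu t ht x₀
    have key := h1 _ (isTypeIAncientMild_translate hu x₀) t ht
    rwa [setIntegral_ball_translate u t x₀ 1] at key
  -- Step 3: all radii (scaling invariance of the class and of the ledger).
  refine ⟨K₁, fun u hu t ht x₀ R hR => ?_⟩
  have htR : t / R ^ 2 < 0 := div_neg_of_neg_of_pos ht (pow_pos hR 2)
  have key := h2 (nsRescale R u) (isTypeIAncientMild_nsRescale hu hR) (t / R ^ 2) htR (R⁻¹ • x₀)
  have e2 : R ^ 2 * (t / R ^ 2) = t := by field_simp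
  rw [setIntegral_ball_nsRescale hR, smul_smul, mul_inv_cancel₀ hR.ne', one_smul, mul_one, e2] at key
  have key' : R⁻¹ * (∫ x in ball x₀ R, ‖u t x‖ ^ 2) ≤ R⁻¹ * (K₁ * R) :=
    key.trans_eq (by field_simp)
  exact le_of_mul_le_mul_left key' (inv_pos.2 hR)


/-- Registered form (sub-goal `fpl_reduction_main` of crux stmt-NavierStokesRegularity-14060): the
unit-window ledger implies the crux. -/
theorem fpl_reduction_main :
    (∀ C : ℝ, ∃ K : ℝ, ∀ (u : ℝ → EuclideanSpace ℝ (Fin 3) → EuclideanSpace ℝ (Fin 3)),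
      Literature.Analysis.FluidPDE.IsTypeIAncientMild C u → ∀ t ∈ Set.Ioo (-1 : ℝ) 0,
      ∫ x in Metric.ball (0 : EuclideanSpace ℝ (Fin 3)) 1, ‖u t x‖ ^ 2 ≤ K) →
    Summit.NavierStokesRegularity.NavierStokesRegularity.Theses.SymmetryModuliCount.FarPastLedger :=
  fun h => crux_of_unitWindow h

end Summit.NavierStokesRegularity.NavierStokesRegularity.Theorems

end
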